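import Literature.AlgebraicGeometry.AbelianSchemes.GraphPointResidueFieldAnyChar
import Literature.AlgebraicGeometry.AbelianVarieties.PicZeroSlicesAnyChar
import HarnessLib

/-!
# (Mc) N3′ LEVEL 0 in ANY characteristic — the graph point `y : Spec Ω → Â′` with `(1 × y)^*𝒫′ ≅ ℒ|_{A′ × x̄}` over every geometric point,
# and the level-0 point over the residue field of EVERY point of the base, with no `[CharZero]` ([MumfordAV1970] §8 Thm. 1, §13 level 0)

Layer `Literature/AlgebraicGeometry/AbelianSchemes`, namespace `Literature.AlgebraicGeometry.AbelianSchemes.AbelianSchemeOver`.  THEOREMS ONLY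
(no definition, no named fact, no instance, no notation, no `sorry`).  Cell `hodgecm-mathlib` (D-0151), DUAL-S road (A): the ANY-CHARACTERISTIC twin
of ★ `GraphPointLevelZero` §2 and the `hlev0`-free form of ★ `GraphPointResidueFieldAnyChar`.  ★ `GraphPointLevelZero` asks `[CharZero Ω]` only
because its one external input, [MumfordAV1970] §8 Theorem 1 in module currency (★ `PicZeroSlicesAnyField`), was in the tree by transport from `ℂ`;
★ (CBC-4) `AbelianVarieties/PicZeroOntoOfFiniteKTheta` (Mumford's own proof, any characteristic) and its module reading ★ `PicZeroSlicesAnyChar`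
remove that, under the hypothesis the proof uses — `K(Θ)(Ω)` FINITE (for `Θ` ample: [MumfordAV1970] §6 Application 1 = ★ `AbelianVariety.finite_KTheta`).

Setting (the (Mc) letters' sockets, as in ★ `GraphPointLevelZero`): an abelian scheme `A′/S′`, a rank-one `L′` on `A′`, a candidate dual `Â′ = hat`
with `π : A′ → Â′`, a rank-one `𝒫′ = P` on `A′ ×_{S′} Â′` with `(1 × π)^*𝒫′ ≅ Λ(L′)` (`hsock`), a base `T′ → S′`, a rigidified `ℒ` on `A′ ×_{S′} T′`
fibrewise in `Pic⁰` (`hℒ`).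

* §1 **`exists_graphPoint_of_fibrewisePicZero_of_finite`** — if every geometric fibre class of `L′` is the class of a divisor `Θ` with `K(Θ)(Ω)`
  finite (`hΘ'`), then for EVERY algebraically closed `Ω` (any characteristic) and every `x : Spec Ω → T′` there is `y : Spec Ω → Â′` over `S′`
  with `(1 × y)^*𝒫′ ≅ (1 × x̄)^*ℒ` on `A′_s̄` — the proof of ★ `exists_graphPoint_of_fibrewisePicZero` token for token with ★
  `exists_detClass_eq_cechClass_weilDiv_of_isHomogeneous_of_finite` as the §8 Theorem 1 input; `…_of_finite_of_eq` — over a prescribed base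
  point (`x ≫ (T′ → S′) = s`), the shape of the `hlev0` binder of ★ `exists_graphPoint_residueField_of_pointsInjective`.
* §2 `forall_exists_finite_cechClass_of_forall_exists_isAmple` — the letters' `_hΘ` (AMPLE fibre classes) gives `hΘ'` (finite `K(Θ)(Ω)`).
* §3 **`exists_graphPoint_residueField_of_sock_of_pointsInjective`** — ★ P2′ `exists_graphPoint_residueField_of_pointsInjective` with its
  `hlev0` binder DISCHARGED: inputs = the letters' sockets (`hL'`, `_hΘ` ample, `π`, `hsock`, `hℒ`) + the all-test-object detection `hinjT`
  (★ `PoincareFamilyPointsInjective.eq_of_nonempty_pullback_poincare_iso` for `Â′ = A′/K(L′)`); for every `t ∈ T′`, a point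
  `y₀ : Spec κ(t) → Â′` over `S′` with `(1 × y₀)^*𝒫′ ≅ (1 × ι_t)^*ℒ` — ★ `exists_graphPoint_residueField` with `[CharZero κ(t)]` REMOVED
  (and `hinj` on geometric points replaced by `hinjT`).

HC_CM is proved only modulo the 7 printed citations until rung 0 closes; nothing here bears on a summit statement (count-neutral ★ capital on the
in-house road to `Nonempty A.DualPair`).

## References
* [MumfordAV1970] D. Mumford, *Abelian Varieties* (1970), §8 Theorem 1 (p. 77) and its proof (pp. 77–78), §8 (i)–(iv) (pp. 74–75), §6 Application 1
  (p. 60), §13 (proof of the Thm., pp. 125–130).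
* [MilneAV2008] J. S. Milne, *Abelian Varieties* (2008), I §8 (pp. 36–37).
* [GortzWedhorn2020] U. Görtz, T. Wedhorn, *Algebraic Geometry I*, 2nd ed. (2020), Thm. 14.72 (descent of morphisms), Section (4.7).
* [MumfordFogartyKirwan1994] D. Mumford, J. Fogarty, F. Kirwan, *Geometric Invariant Theory*, 3rd ed. (1994), Ch. 6 §2 Def. 6.2 (p. 120).
-/

set_option autoImplicit false

noncomputable section

open CategoryTheory CategoryTheory.Limits AlgebraicGeometry MonoidalCategory CartesianMonoidalCategory

-- `(A.fibre s).toAbelianVariety.X.left = pullback A.X.hom s = (A.X ⊗ Over.mk s).left` hold by `rfl` only.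
set_option backward.isDefEq.respectTransparency false

namespace Literature.AlgebraicGeometry.AbelianSchemes

namespace AbelianSchemeOver

open Literature.AlgebraicGeometry.Motives Literature.AlgebraicGeometry.AbelianVarieties
  Literature.AlgebraicGeometry.Modules
open scoped MonObj

variable {S' : Scheme.{0}} (A' : AbelianSchemeOver S')

/-! ## §1 The graph point over a geometric point, any characteristic -/

/-- **N3′ LEVEL 0 in ANY characteristic — a GRAPH POINT over every geometric point of the base.**  `A′/S′` an abelian scheme, `L′` a rank-one
module on `A′` whose geometric fibre classes are classes of divisors `Θ` with `K(Θ)(Ω) = {x ; t_x^*Θ ∼ Θ}` FINITE (`hΘ'`), `π : A′ → Â′`, `𝒫′` rank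
one on `A′ ×_{S′} Â′` with the socket `(1 × π)^*𝒫′ ≅ Λ(L′)` (`hsock`), `ℒ` a rigidified line bundle on `A′ ×_{S′} T′` fibrewise in `Pic⁰`.  Then
for every algebraically closed `Ω` (any characteristic) and every `x : Spec Ω → T′` there is `y : Spec Ω → Â′` over `S′` with
`(1_{A′} × y)^*𝒫′ ≅ (1_{A′} × x̄)^*ℒ` on `A′_s̄`: the slice of `ℒ` is homogeneous (★ `isHomogeneous_pullback_whiskerLeft_of_fibrewisePicZero`), hence a
Mumford bundle `𝒪(t_a^*Θ − Θ)` ([MumfordAV1970] §8 Thm. 1 in any characteristic, ★ `exists_detClass_eq_cechClass_weilDiv_of_isHomogeneous_of_finite`),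
and `y = π(a)` by the socket (★ `pullback_whiskerLeft_mumfordClass_homMk`, ★ `nonempty_iso_iff_detClass_eq`) — the proof of ★
`exists_graphPoint_of_fibrewisePicZero` token for token (its idle binder `hP1 : HasRank P 1` is dropped: the rank of `𝒫′` is not used at level 0).
[cite: MumfordAV1970, §8 Theorem 1 (p. 77) and its proof (pp. 77–78); §13 (proof of the Thm., pp. 125–130)] [cite: MilneAV2008, I §8 (pp. 36–37)] -/
theorem exists_graphPoint_of_fibrewisePicZero_of_finite {L' : A'.left.Modules} (hL' : HasRank L' 1)
    (hΘ' : ∀ ⦃Ω : Type⦄ [Field Ω] [IsAlgClosed Ω] (s : Spec (.of Ω) ⟶ S'),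
      ∃ Θ : CartierDivisor (A'.fibre s).toAbelianVariety.X.left,
        {x : (A'.fibre s).toAbelianVariety.Points Ω | ((A'.fibre s).toAbelianVariety.weilDiv Θ x).LinEquiv 0}.Finite ∧
        CechPic.pullback (X := (A'.fibre s).toAbelianVariety.X.left) (pullback.fst A'.X.hom s)
          (detClass (HasRank.isFiniteLocallyFree' hL')) = Θ.cechClass)
    (hat : AbelianSchemeOver S') (π : A'.X ⟶ hat.X) (P : (A'.prodLeft hat).Modules)
    (hsock : Nonempty ((Scheme.Modules.pullback (A'.X ◁ π).left).obj P ≅ A'.mumfordBundle L'))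
    {T' : Over S'} (ℒ : A'.RigidifiedLineBundle T'.hom) (hℒ : ℒ.FibrewisePicZero)
    {Ω : Type} [Field Ω] [IsAlgClosed Ω] (x : Spec (.of Ω) ⟶ T'.left) :
    ∃ y : Over.mk (x ≫ T'.hom) ⟶ hat.X,
      Nonempty ((Scheme.Modules.pullback (A'.baseChangeToProd hat (x ≫ T'.hom) y.left (Over.w y))).obj P ≅
        (Scheme.Modules.pullback (A'.X ◁ (Over.homMk x rfl : Over.mk (x ≫ T'.hom) ⟶ T')).left).obj ℒ.L) := by
  classical
  -- the fibre abelian variety `X = A′_s̄` over `Ω` and the slice `E = (1 × x̄)^*ℒ` on it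
  obtain ⟨Θ, hΘK, hΘc⟩ := hΘ' (x ≫ T'.hom)
  have hE1 : HasRank ((Scheme.Modules.pullback
      (A'.X ◁ (Over.homMk x rfl : Over.mk (x ≫ T'.hom) ⟶ T')).left).obj ℒ.L) 1 :=
    hasRank_pullback _ ℒ.hasRank_one
  have hhom := RigidifiedLineBundle.isHomogeneous_pullback_whiskerLeft_of_fibrewisePicZero A' ℒ hℒ x
  -- [MumfordAV1970] §8 Thm. 1 over `Ω`, any characteristic: `[E] = [𝒪(t_a^*Θ − Θ)]`
  obtain ⟨a, ha⟩ := exists_detClass_eq_cechClass_weilDiv_of_isHomogeneous_of_finite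
    (A'.fibre (x ≫ T'.hom)).toAbelianVariety Θ hΘK hE1 hhom
  -- the graph point `y := π(a)`
  let â : Over.mk (x ≫ T'.hom) ⟶ A'.X :=
    Over.homMk (A'.fibrePointToLeft (x ≫ T'.hom) a) (A'.fibrePointToLeft_comp_hom (x ≫ T'.hom) a)
  refine ⟨â ≫ π, ?_⟩
  -- `(1 × π a)^*𝒫′ ≅ (1 × a)^*(1 × π)^*𝒫′ ≅ (1 × a)^*Λ(L′)`
  have hb : A'.baseChangeToProd hat (x ≫ T'.hom) (â ≫ π).left (Over.w (â ≫ π)) = (A'.X ◁ (â ≫ π)).left :=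
    A'.baseChangeToProd_eq_whiskerLeft_left hat (â ≫ π)
  have hcomp : (A'.X ◁ (â ≫ π)).left = (A'.X ◁ â).left ≫ (A'.X ◁ π).left := by
    rw [MonoidalCategory.whiskerLeft_comp, Over.comp_left]
  let e₁ : (Scheme.Modules.pullback (A'.baseChangeToProd hat (x ≫ T'.hom) (â ≫ π).left (Over.w (â ≫ π)))).obj P ≅
      (Scheme.Modules.pullback (A'.X ◁ â).left).obj (A'.mumfordBundle L') :=
    (Scheme.Modules.pullbackCongr (hb.trans hcomp)).app P ≪≫
      ((Scheme.Modules.pullbackComp (A'.X ◁ â).left (A'.X ◁ π).left).app P).symm ≪≫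
      (Scheme.Modules.pullback (A'.X ◁ â).left).mapIso hsock.some
  -- classes: `[(1 × a)^*Λ(L′)] = t_a^*[Θ]·[Θ]⁻¹ = [𝒪(t_a^*Θ − Θ)] = [E]`
  have hΛ : IsFiniteLocallyFree (A'.mumfordBundle L') := HasRank.isFiniteLocallyFree' (A'.hasRank_mumfordBundle hL')
  have hM1 : HasRank ((Scheme.Modules.pullback (A'.X ◁ â).left).obj (A'.mumfordBundle L')) 1 :=
    hasRank_pullback _ (A'.hasRank_mumfordBundle hL')
  have hcl : detClass (hΛ.pullback (A'.X ◁ â).left) =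
      ((A'.fibre (x ≫ T'.hom)).toAbelianVariety.weilDiv Θ a).cechClass := by
    rw [detClass_pullback _ hΛ, A'.detClass_mumfordBundle hL' hΛ,
      A'.pullback_whiskerLeft_mumfordClass_homMk (x ≫ T'.hom) (detClass (HasRank.isFiniteLocallyFree' hL')) a]
    have hΘc' : CechPic.pullback (CartesianMonoidalCategory.fst A'.X (Over.mk (x ≫ T'.hom))).left
        (detClass (HasRank.isFiniteLocallyFree' hL')) = Θ.cechClass := hΘc
    have hneg : (-Θ).cechClass = Θ.cechClass⁻¹ := by
      have h0 : (Θ + -Θ).cechClass = 1 := by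
        rw [(CartierDivisor.cechClass_eq_iff_linEquiv _ _).2
          (CartierDivisor.LinEquiv.add_neg (CartierDivisor.LinEquiv.refl Θ)), CartierDivisor.cechClass_zero]
      rw [CartierDivisor.cechClass_add] at h0
      exact eq_inv_of_mul_eq_one_right h0
    rw [hΘc', AbelianVariety.weilDiv, CartierDivisor.cechClass_add, CartierDivisor.cechClass_pullback, hneg]
    rfl
  refine ⟨e₁ ≪≫ ((nonempty_iso_iff_detClass_eq hM1 hE1 (hΛ.pullback (A'.X ◁ â).left)
    (HasRank.isFiniteLocallyFree' hE1)).2 (hcl.trans ha.symm)).some⟩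

/-- **N3′ LEVEL 0, ANY characteristic, over a prescribed base point** (`s : Spec Ω → S′`, `x : Spec Ω → T′` with `x ≫ (T′ → S′) = s`,
`x̄ = Over.homMk x hs`): there is `y : Over.mk s ⟶ Â′` with `(1 × y)^*𝒫′ ≅ (1 × x̄)^*ℒ` — the `subst` of `exists_graphPoint_of_fibrewisePicZero_of_finite`;
this is, letter for letter, the `hlev0` binder of ★ `exists_graphPoint_residueField_of_pointsInjective`.
[cite: MumfordAV1970, §8 Theorem 1 (p. 77) and §13 (proof of the Thm., pp. 125–130)] -/
theorem exists_graphPoint_of_fibrewisePicZero_of_finite_of_eq {L' : A'.left.Modules} (hL' : HasRank L' 1)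
    (hΘ' : ∀ ⦃Ω : Type⦄ [Field Ω] [IsAlgClosed Ω] (s : Spec (.of Ω) ⟶ S'),
      ∃ Θ : CartierDivisor (A'.fibre s).toAbelianVariety.X.left,
        {x : (A'.fibre s).toAbelianVariety.Points Ω | ((A'.fibre s).toAbelianVariety.weilDiv Θ x).LinEquiv 0}.Finite ∧
        CechPic.pullback (X := (A'.fibre s).toAbelianVariety.X.left) (pullback.fst A'.X.hom s)
          (detClass (HasRank.isFiniteLocallyFree' hL')) = Θ.cechClass)
    (hat : AbelianSchemeOver S') (π : A'.X ⟶ hat.X) (P : (A'.prodLeft hat).Modules)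
    (hsock : Nonempty ((Scheme.Modules.pullback (A'.X ◁ π).left).obj P ≅ A'.mumfordBundle L'))
    {T' : Over S'} (ℒ : A'.RigidifiedLineBundle T'.hom) (hℒ : ℒ.FibrewisePicZero)
    {Ω : Type} [Field Ω] [IsAlgClosed Ω] (s : Spec (.of Ω) ⟶ S') (x : Spec (.of Ω) ⟶ T'.left)
    (hs : x ≫ T'.hom = s) :
    ∃ y : Over.mk s ⟶ hat.X,
      Nonempty ((Scheme.Modules.pullback (A'.baseChangeToProd hat s y.left (Over.w y))).obj P ≅
        (Scheme.Modules.pullback (A'.X ◁ (Over.homMk x hs : Over.mk s ⟶ T')).left).obj ℒ.L) := by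
  subst hs
  exact A'.exists_graphPoint_of_fibrewisePicZero_of_finite hL' hΘ' hat π P hsock ℒ hℒ x

/-! ## §2 The letters' `_hΘ` (ample fibre classes) gives finite `K(Θ)(Ω)` fibre classes -/

/-- **Ample fibre classes have finite `K(Θ)(Ω)`**: if at every geometric point `s` of `S′` the fibre class of the rank-one `L′` is `[𝒪(Θ)]` with
`Θ` AMPLE (the (Mc) letters' `_hΘ`), then it is `[𝒪(Θ)]` with `K(Θ)(Ω) = {x ; t_x^*Θ ∼ Θ}` finite — [MumfordAV1970] §6 Application 1
(★ `AbelianVariety.finite_KTheta`).  This converts the printed hypothesis into the one §1 consumes.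
[cite: MumfordAV1970, §6 Application 1 (p. 60)] -/
theorem forall_exists_finite_cechClass_of_forall_exists_isAmple {L' : A'.left.Modules} (hL' : HasRank L' 1)
    (hΘ' : ∀ ⦃Ω : Type⦄ [Field Ω] [IsAlgClosed Ω] (s : Spec (.of Ω) ⟶ S'),
      ∃ Θ : CartierDivisor (A'.fibre s).toAbelianVariety.X.left, Θ.IsAmple ∧
        CechPic.pullback (X := (A'.fibre s).toAbelianVariety.X.left) (pullback.fst A'.X.hom s)
          (detClass (HasRank.isFiniteLocallyFree' hL')) = Θ.cechClass)
    ⦃Ω : Type⦄ [Field Ω] [IsAlgClosed Ω] (s : Spec (.of Ω) ⟶ S') :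
    ∃ Θ : CartierDivisor (A'.fibre s).toAbelianVariety.X.left,
      {x : (A'.fibre s).toAbelianVariety.Points Ω | ((A'.fibre s).toAbelianVariety.weilDiv Θ x).LinEquiv 0}.Finite ∧
      CechPic.pullback (X := (A'.fibre s).toAbelianVariety.X.left) (pullback.fst A'.X.hom s)
        (detClass (HasRank.isFiniteLocallyFree' hL')) = Θ.cechClass := by
  obtain ⟨Θ, hamp, hc⟩ := hΘ' s
  exact ⟨Θ, (A'.fibre s).toAbelianVariety.finite_KTheta hamp, hc⟩

/-! ## §3 The level-0 graph point over the residue field of every point of the base, any characteristic, from the sockets -/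

/-- **THE LEVEL-0 GRAPH POINT OVER `κ(t)` FOR EVERY `t ∈ T′`, ANY CHARACTERISTIC, FROM THE SOCKETS** — ★ P2′
`exists_graphPoint_residueField_of_pointsInjective` with its `hlev0` binder DISCHARGED by §1∕§2 ([MumfordAV1970] §8 Theorem 1 being now in the
tree in any characteristic, ★ CBC-4): for `A′/S′`, a rank-one `L′` with AMPLE geometric fibre classes (`hΘ'`, the letters' `_hΘ`), `π : A′ → Â′`,
a rank-one `𝒫′` with `(1 × π)^*𝒫′ ≅ Λ(L′)` (`hsock`), a rigidified `ℒ` on `A′ ×_{S′} T′` fibrewise in `Pic⁰` (`hℒ`), and points of `Â′` detected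
by `𝒫′` on ALL test objects (`hinjT`, ★ `PoincareFamilyPointsInjective.eq_of_nonempty_pullback_poincare_iso` for `Â′ = A′/K(L′)`), every
`t ∈ T′` carries `y₀ : Spec κ(t) → Â′` over `S′` with `(1_{A′} × y₀)^*𝒫′ ≅ (1_{A′} × ι_t)^*ℒ` on `A′_{κ(t)}` — ★ `exists_graphPoint_residueField`
without `[CharZero κ(t)]` (fpqc descent of the `κ(t)^alg`-point, ★ `GraphPointResidueFieldAnyChar`).
[cite: MumfordAV1970, §8 Theorem 1 (p. 77) and §13 (proof of the Thm., pp. 125–130)] [cite: GortzWedhorn2020, Thm. 14.72] -/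
theorem exists_graphPoint_residueField_of_sock_of_pointsInjective {L' : A'.left.Modules} (hL' : HasRank L' 1)
    (hΘ' : ∀ ⦃Ω : Type⦄ [Field Ω] [IsAlgClosed Ω] (s : Spec (.of Ω) ⟶ S'),
      ∃ Θ : CartierDivisor (A'.fibre s).toAbelianVariety.X.left, Θ.IsAmple ∧
        CechPic.pullback (X := (A'.fibre s).toAbelianVariety.X.left) (pullback.fst A'.X.hom s)
          (detClass (HasRank.isFiniteLocallyFree' hL')) = Θ.cechClass)
    (hat : AbelianSchemeOver S') (π : A'.X ⟶ hat.X) (P : (A'.prodLeft hat).Modules) (hP1 : HasRank P 1)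
    (hsock : Nonempty ((Scheme.Modules.pullback (A'.X ◁ π).left).obj P ≅ A'.mumfordBundle L'))
    {T' : Over S'} (ℒ : A'.RigidifiedLineBundle T'.hom) (hℒ : ℒ.FibrewisePicZero)
    (hinjT : ∀ ⦃T : Over S'⦄ (y y' : T ⟶ hat.X),
      Nonempty ((Scheme.Modules.pullback (A'.baseChangeToProd hat T.hom y.left (Over.w y))).obj P ≅
        (Scheme.Modules.pullback (A'.baseChangeToProd hat T.hom y'.left (Over.w y'))).obj P) → y = y')
    (t : T'.left) :
    ∃ y₀ : Over.mk (T'.left.fromSpecResidueField t ≫ T'.hom) ⟶ hat.X,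
      Nonempty ((Scheme.Modules.pullback (A'.baseChangeToProd hat (T'.left.fromSpecResidueField t ≫ T'.hom) y₀.left (Over.w y₀))).obj P ≅
        (Scheme.Modules.pullback (A'.X ◁ (Over.homMk (T'.left.fromSpecResidueField t) rfl :
          Over.mk (T'.left.fromSpecResidueField t ≫ T'.hom) ⟶ T')).left).obj ℒ.L) :=
  A'.exists_graphPoint_residueField_of_pointsInjective hat P hP1 ℒ
    (fun _Ω _ _ s x hs => A'.exists_graphPoint_of_fibrewisePicZero_of_finite_of_eq hL'
      (A'.forall_exists_finite_cechClass_of_forall_exists_isAmple hL' hΘ') hat π P hsock ℒ hℒ s x hs)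
    hinjT t

end AbelianSchemeOver

end Literature.AlgebraicGeometry.AbelianSchemes

end
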